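import Mathlib
import Summits.KontsevichZagierPeriods.Zeta5Search.ClassFunctionPF
import HarnessLib

/-!
# ζ(5) search — the PARTIAL-FRACTION IDENTITY for the class function `Φ_x` and the residue theorem for `η^k Φ_x`

Cell `pub-zeta5` (HONEST FRAMING: systematic search; no irrationality claim unless certified), typer seat
generation 9; part 2 of `ClassFunctionPF.lean` (where `Φ_x = N/D`, the levels and the local expansion
`N(ℓ_q + ε) = classCofactor_q(ε)·D_q(ℓ_q + ε)` are set up):

* `classPF`: `X^k · N = Σ_{q pole} Σ_{σ=1}^{n_q} ρ^{(k)}_{q,σ} · (D/(X − ℓ_q)^σ)` whenever `deg(X^k N) < deg D`, with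
  `ρ^{(k)}_{q,σ} = [ε^{n_q−σ}] (ℓ_q + ε)^k·classCofactor_q(ε)` (`rhoK`) — the difference vanishes to order `n_q` at every `ℓ_q`
  (through the power series), the `(X − ℓ_q)^{n_q}` are pairwise coprime, and the degree is `< deg D`;
* `classResidueSum`: comparing the coefficients of `X^{P−1}`: **`Σ_q ρ^{(k)}_{q,1} = [Z + k + 1 = P]`** — the residue theorem for
  `η^k Φ_x` (sum of the finite residues `=` minus the residue at infinity).  Gen-2 g9's three residue identities
  (`RhoResidueIdentities`) are the cases `k = 0, 1, 2` (next file).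
Pure polynomial / power-series algebra over `ℚ`; nothing about irrationality.
-/

noncomputable section

open Finset Polynomial

namespace Summit.KontsevichZagierPeriods.Zeta5Search.ClusterValuation

open Summit.KontsevichZagierPeriods.Zeta5Search.DualSeries (InBox)
open Summit.KontsevichZagierPeriods.Zeta5Search.CasoratianValuation (InPolytope)

/-! ### The partial-fraction identity -/

/-- `ρ^{(k)}_{q,σ} := [ε^{n_q − σ}] (ε + ℓ_q)^k · classCofactor_q(ε)`. -/
def rhoK (b : ℕ → ℤ) (p q k σ : ℕ) : ℚ :=
  PowerSeries.coeff ((-netExp b q).toNat - σ) ((PowerSeries.X + PowerSeries.C (lvl p q)) ^ k * classCofactor b p q)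

/-- `M_{q,σ} := D_q · (X − ℓ_q)^{n_q − σ} = D/(X − ℓ_q)^σ`. -/
def pfM (b : ℕ → ℤ) (p x q σ : ℕ) : ℚ[X] := denOff b p x q * (X - C (lvl p q)) ^ ((-netExp b q).toNat - σ)

/-- The composed `M_{q',σ}` for `q' ≠ q` vanishes to order `n_q` at `ℓ_q`. -/
theorem X_pow_dvd_pfM_comp (b : ℕ → ℤ) {p x q q' : ℕ} (hq : q ∈ classPoles b p x) (hne : q ≠ q') (σ : ℕ) :
    (X : ℚ[X]) ^ (-netExp b q).toNat ∣ (pfM b p x q' σ).comp (X + C (lvl p q)) := by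
  have hmem : q ∈ (classPoles b p x).erase q' := mem_erase.2 ⟨hne, hq⟩
  have h1 : (X - C (lvl p q)) ^ (-netExp b q).toNat ∣ pfM b p x q' σ := by
    unfold pfM denOff
    exact (dvd_prod_of_mem _ hmem).mul_right _
  obtain ⟨T, hT⟩ := h1
  refine ⟨T.comp (X + C (lvl p q)), ?_⟩
  rw [hT, mul_comp, pow_comp, sub_comp, X_comp, C_comp, add_sub_cancel_right]

/-- **THE PARTIAL-FRACTION IDENTITY**: `X^k · N = Σ_{q,σ} ρ^{(k)}_{q,σ} · M_{q,σ}` when `Z + k < P`. -/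
theorem classPF (b : ℕ → ℤ) {p x : ℕ} (hp : 0 < p) (k : ℕ) (hdeg : degN b p x + k < degD b p x) :
    (X : ℚ[X]) ^ k * numPhi b p x =
      ∑ q ∈ classPoles b p x, ∑ σ ∈ Icc 1 (-netExp b q).toNat, C (rhoK b p q k σ) * pfM b p x q σ := by
  set R := (X : ℚ[X]) ^ k * numPhi b p x -
    ∑ q ∈ classPoles b p x, ∑ σ ∈ Icc 1 (-netExp b q).toNat, C (rhoK b p q k σ) * pfM b p x q σ with hR
  suffices hR0 : R = 0 by rw [← sub_eq_zero]; exact hR0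
  -- `R` is divisible by every `(X − ℓ_q)^{n_q}`
  have hdvd : ∀ q ∈ classPoles b p x, (X - C (lvl p q)) ^ (-netExp b q).toNat ∣ R := by
    intro q hq
    -- work with `R ∘ (X + ℓ_q)` and show its low coefficients vanish
    suffices hR' : (X : ℚ[X]) ^ (-netExp b q).toNat ∣ R.comp (X + C (lvl p q)) by
      obtain ⟨T, hT⟩ := hR'
      refine ⟨T.comp (X - C (lvl p q)), ?_⟩
      have : R = (R.comp (X + C (lvl p q))).comp (X - C (lvl p q)) := by
        rw [comp_assoc, add_comp, X_comp, C_comp, sub_add_cancel, comp_X]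
      rw [this, hT, mul_comp, pow_comp, X_comp]
    rw [Polynomial.X_pow_dvd_iff]
    intro m hm
    -- distribute the composition
    have hsum : R.comp (X + C (lvl p q)) = ((X : ℚ[X]) ^ k * numPhi b p x).comp (X + C (lvl p q)) -
        ∑ q' ∈ classPoles b p x, ∑ σ ∈ Icc 1 (-netExp b q').toNat,
          (C (rhoK b p q' k σ) * pfM b p x q' σ).comp (X + C (lvl p q)) := by
      rw [hR, sub_comp]
      congr 1
      rw [← coe_compRingHom_apply, map_sum]
      refine sum_congr rfl fun q' _ => ?_
      rw [map_sum]
      exact sum_congr rfl fun σ _ => by rw [coe_compRingHom_apply]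
    -- the `q' ≠ q` terms vanish below degree `n_q`
    have hoff : ∀ q' ∈ (classPoles b p x).erase q, ∀ σ ∈ Icc 1 (-netExp b q').toNat,
        ((C (rhoK b p q' k σ) * pfM b p x q' σ).comp (X + C (lvl p q))).coeff m = 0 := by
      intro q' hq' σ _
      obtain ⟨hne, -⟩ := mem_erase.1 hq'
      obtain ⟨T, hT⟩ := X_pow_dvd_pfM_comp b hq (Ne.symm hne) σ
      rw [mul_comp, C_comp, hT, coeff_C_mul, coeff_X_pow_mul', if_neg (by omega), mul_zero]
    -- the `q` terms, through the power series
    have hmain : (((X : ℚ[X]) ^ k * numPhi b p x).comp (X + C (lvl p q))).coeff m =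
        ∑ σ ∈ Icc 1 (-netExp b q).toNat, ((C (rhoK b p q k σ) * pfM b p x q σ).comp (X + C (lvl p q))).coeff m := by
      -- both sides as power-series coefficients against `D_q ∘ (X + ℓ_q)`
      have hG : (((((X : ℚ[X]) ^ k * numPhi b p x).comp (X + C (lvl p q))) : ℚ[X]) : PowerSeries ℚ) =
          ((PowerSeries.X + PowerSeries.C (lvl p q)) ^ k * classCofactor b p q) *
            (((denOff b p x q).comp (X + C (lvl p q)) : ℚ[X]) : PowerSeries ℚ) := by
        rw [mul_comp, pow_comp, X_comp, Polynomial.coe_mul, Polynomial.coe_pow, Polynomial.coe_add, Polynomial.coe_X,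
          Polynomial.coe_C, numPhi_comp_eq b hp hq, mul_assoc]
      have hon : ∀ σ ∈ Icc 1 (-netExp b q).toNat,
          ((((C (rhoK b p q k σ) * pfM b p x q σ).comp (X + C (lvl p q))) : ℚ[X]) : PowerSeries ℚ) =
            (PowerSeries.C (rhoK b p q k σ) * PowerSeries.X ^ ((-netExp b q).toNat - σ)) *
              (((denOff b p x q).comp (X + C (lvl p q)) : ℚ[X]) : PowerSeries ℚ) := by
        intro σ _
        rw [pfM, mul_comp, mul_comp, C_comp, pow_comp, sub_comp, X_comp, C_comp, add_sub_cancel_right, Polynomial.coe_mul,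
          Polynomial.coe_mul, Polynomial.coe_C, Polynomial.coe_pow, Polynomial.coe_X]
        ring
      -- the truncation `G − Σ_σ ρ_σ X^{n−σ}` vanishes below degree `n_q`
      have htrunc : PowerSeries.X ^ (-netExp b q).toNat ∣
          (PowerSeries.X + PowerSeries.C (lvl p q)) ^ k * classCofactor b p q -
            ∑ σ ∈ Icc 1 (-netExp b q).toNat, PowerSeries.C (rhoK b p q k σ) * PowerSeries.X ^ ((-netExp b q).toNat - σ) := by
        rw [PowerSeries.X_pow_dvd_iff]
        intro i hi
        rw [map_sub, map_sum]
        have hterm : ∀ σ ∈ Icc 1 (-netExp b q).toNat,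
            PowerSeries.coeff i (PowerSeries.C (rhoK b p q k σ) * PowerSeries.X ^ ((-netExp b q).toNat - σ)) =
              if σ = (-netExp b q).toNat - i then rhoK b p q k σ else 0 := by
          intro σ hσ
          have hσ' := mem_Icc.1 hσ
          rw [PowerSeries.coeff_C_mul, PowerSeries.coeff_X_pow]
          by_cases h : σ = (-netExp b q).toNat - i
          · rw [if_pos (by omega), if_pos h, mul_one]
          · rw [if_neg (by omega), if_neg h, mul_zero]
        rw [sum_congr rfl hterm, sum_ite_eq' (Icc 1 _), if_pos (mem_Icc.2 ⟨by omega, by omega⟩), rhoK,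
          show (-netExp b q).toNat - ((-netExp b q).toNat - i) = i by omega, sub_self]
      obtain ⟨T, hT⟩ := htrunc
      have hdiff : (((X : ℚ[X]) ^ k * numPhi b p x).comp (X + C (lvl p q))).coeff m -
          ∑ σ ∈ Icc 1 (-netExp b q).toNat, ((C (rhoK b p q k σ) * pfM b p x q σ).comp (X + C (lvl p q))).coeff m =
          PowerSeries.coeff m ((PowerSeries.X ^ (-netExp b q).toNat * T) *
            (((denOff b p x q).comp (X + C (lvl p q)) : ℚ[X]) : PowerSeries ℚ)) := by
        rw [← hT, sub_mul, map_sub, sum_mul, map_sum]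
        congr 1
        · rw [← Polynomial.coeff_coe, hG]
        · refine sum_congr rfl fun σ hσ => ?_
          rw [← Polynomial.coeff_coe, hon σ hσ]
      have h0 : PowerSeries.coeff m ((PowerSeries.X ^ (-netExp b q).toNat * T) *
          (((denOff b p x q).comp (X + C (lvl p q)) : ℚ[X]) : PowerSeries ℚ)) = 0 := by
        rw [mul_assoc, PowerSeries.coeff_X_pow_mul', if_neg (by omega)]
      rw [h0] at hdiff
      linarith
    rw [hsum, coeff_sub, finsetSum_coeff, ← add_sum_erase _ _ hq, finsetSum_coeff, ← hmain,
      sum_eq_zero (fun q' hq' => by rw [finsetSum_coeff]; exact sum_eq_zero (hoff q' hq')), add_zero, sub_self]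
  -- hence `D ∣ R`
  have hD : denPhi b p x ∣ R := by
    unfold denPhi
    refine Finset.prod_dvd_of_coprime ?_ hdvd
    intro q₁ hq₁ q₂ hq₂ hne
    have h1 := (mem_filter.1 (Finset.mem_coe.1 hq₁)).1
    have h2 := (mem_filter.1 (Finset.mem_coe.1 hq₂)).1
    exact (isCoprime_X_sub_C_of_isUnit_sub
      (isUnit_iff_ne_zero.2 (sub_ne_zero.2 (lvl_ne_of_ne b hp h1 h2 hne)))).pow
  -- and `deg R < deg D`
  have hP : 0 < degD b p x := by omega
  have hdegR : R.natDegree < (denPhi b p x).natDegree := by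
    rw [denPhi_natDegree]
    have h1 : ((X : ℚ[X]) ^ k * numPhi b p x).natDegree ≤ degD b p x - 1 := by
      rw [Monic.natDegree_mul (monic_X_pow k) (numPhi_monic b p x), natDegree_X_pow, numPhi_natDegree]; omega
    have h2 : (∑ q ∈ classPoles b p x, ∑ σ ∈ Icc 1 (-netExp b q).toNat, C (rhoK b p q k σ) * pfM b p x q σ).natDegree ≤
        degD b p x - 1 := by
      refine natDegree_sum_le_of_forall_le _ _ fun q hq => natDegree_sum_le_of_forall_le _ _ fun σ hσ => ?_
      have hσ' := mem_Icc.1 hσ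
      refine (natDegree_C_mul_le _ _).trans ?_
      unfold pfM
      rw [Monic.natDegree_mul (denOff_monic b p x q) ((monic_X_sub_C _).pow _), natDegree_pow, natDegree_X_sub_C, mul_one]
      have := denOff_natDegree b p x hq
      omega
    have h3 : R.natDegree ≤ degD b p x - 1 := by
      rw [hR]; exact (natDegree_sub_le_iff_left h2).2 h1
    omega
  exact eq_zero_of_dvd_of_natDegree_lt hD hdegR

/-- **THE RESIDUE THEOREM for `η^k Φ_x`**: `Σ_q ρ^{(k)}_{q,1} = [Z + k + 1 = P]` when `Z + k < P`. -/
theorem classResidueSum (b : ℕ → ℤ) {p x : ℕ} (hp : 0 < p) (k : ℕ) (hdeg : degN b p x + k < degD b p x) :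
    ∑ q ∈ classPoles b p x, rhoK b p q k 1 = if degN b p x + k + 1 = degD b p x then 1 else 0 := by
  have hPF := congrArg (fun f : ℚ[X] => f.coeff (degD b p x - 1)) (classPF b hp k hdeg)
  simp only [finsetSum_coeff, coeff_C_mul] at hPF
  -- left side: the top coefficient of the monic `X^k N`
  have hL : ((X : ℚ[X]) ^ k * numPhi b p x).coeff (degD b p x - 1) = if degN b p x + k + 1 = degD b p x then 1 else 0 := by
    have hmon : ((X : ℚ[X]) ^ k * numPhi b p x).Monic := (monic_X_pow k).mul (numPhi_monic b p x)
    have hnd : ((X : ℚ[X]) ^ k * numPhi b p x).natDegree = k + degN b p x := by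
      rw [Monic.natDegree_mul (monic_X_pow k) (numPhi_monic b p x), natDegree_X_pow, numPhi_natDegree]
    split_ifs with h
    · have : degD b p x - 1 = ((X : ℚ[X]) ^ k * numPhi b p x).natDegree := by rw [hnd]; omega
      rw [this]; exact hmon.coeff_natDegree
    · exact coeff_eq_zero_of_natDegree_lt (by rw [hnd]; omega)
  -- right side: only `σ = 1` reaches degree `P − 1`
  have hM : ∀ q ∈ classPoles b p x, ∀ σ ∈ Icc 1 (-netExp b q).toNat,
      rhoK b p q k σ * (pfM b p x q σ).coeff (degD b p x - 1) = if σ = 1 then rhoK b p q k 1 else 0 := by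
    intro q hq σ hσ
    have hσ' := mem_Icc.1 hσ
    have hnq : (-netExp b q).toNat ≤ degD b p x := by have := denOff_natDegree b p x hq; omega
    have hmon : (pfM b p x q σ).Monic := (denOff_monic b p x q).mul ((monic_X_sub_C _).pow _)
    have hnd : (pfM b p x q σ).natDegree = degD b p x - σ := by
      unfold pfM
      rw [Monic.natDegree_mul (denOff_monic b p x q) ((monic_X_sub_C _).pow _), natDegree_pow, natDegree_X_sub_C, mul_one]
      have := denOff_natDegree b p x hq
      omega
    split_ifs with h1
    · subst h1
      have : degD b p x - 1 = (pfM b p x q 1).natDegree := by rw [hnd]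
      rw [this, hmon.coeff_natDegree, mul_one]
    · rw [coeff_eq_zero_of_natDegree_lt (by rw [hnd]; omega), mul_zero]
  rw [hL] at hPF
  rw [hPF]
  refine sum_congr rfl fun q hq => ?_
  rw [sum_congr rfl (hM q hq), sum_ite_eq' (Icc 1 _), if_pos]
  exact mem_Icc.2 ⟨le_rfl, by have := (mem_filter.1 hq).2; omega⟩

end Summit.KontsevichZagierPeriods.Zeta5Search.ClusterValuation

end
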